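import Summits.NavierStokesRegularity.NavierStokesRegularity.Theorems.TypeILiouvilleTypeIliouvilleNoTypeIIEternalSplitModL
import Summits.NavierStokesRegularity.NavierStokesRegularity.Theorems.EulerZoomLiouvillePowerGaugeEulerLiouvilleBackwardPoincare
import HarnessLib

/-!
# Pointwise lower bounds are incompatible with the energy currency: on every parabolic cylinder an
# EEL′-class profile (and its gradient) comes close to zero (crux `TypeIliouvilleNoTypeII`,
# stmt-NavierStokesRegularity-0056; rigidity residual EEL′ of the pressure-free eternal split)

Helper file (theorems only) — two elementary necessary properties of the open core of EEL′ (bounded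
eternal profiles with Albritton–Barker's `A_ess, E ≤ I` on ALL parabolic balls), generalising the
kill of nonzero constant flows (critics' model row M10, `slice_eq_zero_of_const_of_cknAEss_le`):

* `mul_le_cknAEss_of_le_norm` — if `m₀ ≤ ‖v‖` on the whole cylinder `Q_r(z)`, then
  `m₀² · |B₁| · r² ≤ A_ess(v; Q_r(z))`; hence (`inf_norm_small_of_cknAEss_le`) under `A_ess ≤ I`:
  `m₀² |B₁| r² ≤ I` — the profile is `≲ √I / r` SOMEWHERE in every parabolic cylinder of radius `r`
  (no uniform lower bound on large cylinders: plane-wave-like or uniformly swirling candidates die);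
* `mul_le_cknE_of_le_frobeniusNormSq` / `inf_dissipation_small_of_cknE_le` — if `g₀ ≤ |G|²_F` on
  `Q_r(z)` then `g₀ · |B₁| · r⁴ ≤ E(G; Q_r(z))`, so under `E ≤ I` the dissipation density is
  `≤ I/(|B₁| r⁴)` somewhere in every cylinder.

Pure measure theory over the tree's `cknAEss`, `cknE`.  WHAT THIS IS NOT: not NS; EEL′ stays OPEN.
[folklore]
-/

noncomputable section

-- the summit and its single problem share the name `NavierStokesRegularity` (D-0017 nested layout)
set_option linter.dupNamespace false

open Set Function Filter Topology MeasureTheory Metric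
open scoped NNReal ENNReal

namespace Summit.NavierStokesRegularity.NavierStokesRegularity.Theorems.TypeIliouvilleNoTypeII.TypeIIZoom

open Literature.Analysis Literature.Analysis.FluidPDE
open Summit.NavierStokesRegularity.NavierStokesRegularity.Theorems.PowerGaugeEulerLiouville.Backward (volume_ball_eq)

variable {v : ℝ → EuclideanSpace ℝ (Fin 3) → EuclideanSpace ℝ (Fin 3)}

/-! ## `A_ess` against a pointwise lower bound -/

/-- **A pointwise lower bound on a cylinder feeds `A_ess`.**  If `m₀ ≤ ‖v(s, y)‖` for all
`(s, y) ∈ Q_r(z)` (`0 ≤ m₀`, `0 < r`), then `m₀² · |B₁| · r² ≤ A_ess(v; Q_r(z))`: every slice energy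
`r⁻¹ ∫_{B_r} |v(s)|²` on the window is `≥ r⁻¹ m₀² |B_r| = m₀² |B₁| r²`, and the essential supremum over
the (non-null) window is at least that. [folklore] -/
theorem mul_le_cknAEss_of_le_norm {m₀ r : ℝ} (hm₀ : 0 ≤ m₀) (hr : 0 < r)
    {z : ℝ × EuclideanSpace ℝ (Fin 3)}
    (hlow : ∀ q ∈ parabolicCylinder r z, m₀ ≤ ‖v q.1 q.2‖) :
    ENNReal.ofReal (m₀ ^ 2) * volume (ball (0 : EuclideanSpace ℝ (Fin 3)) 1) * ENNReal.ofReal (r ^ 2) ≤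
      cknAEss r z v := by
  have hr0 : ENNReal.ofReal r ≠ 0 := (ENNReal.ofReal_pos.2 hr).ne'
  -- each slice of the window
  have hslice : ∀ s ∈ Ioo (z.1 - r ^ 2) z.1,
      ENNReal.ofReal (m₀ ^ 2) * volume (ball (0 : EuclideanSpace ℝ (Fin 3)) 1) * ENNReal.ofReal (r ^ 2) ≤
        (ENNReal.ofReal r)⁻¹ * ∫⁻ y in ball z.2 r, ‖v s y‖ₑ ^ 2 := by
    intro s hs
    have hpt : ∀ y ∈ ball z.2 r, ENNReal.ofReal (m₀ ^ 2) ≤ ‖v s y‖ₑ ^ 2 := by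
      intro y hy
      have h := hlow (s, y) (by
        rw [mem_parabolicCylinder]
        exact ⟨hs, by rwa [mem_ball] at hy⟩)
      rw [← ofReal_norm, ← ENNReal.ofReal_pow (norm_nonneg _)]
      exact ENNReal.ofReal_le_ofReal (pow_le_pow_left₀ hm₀ h 2)
    have hint : ENNReal.ofReal (m₀ ^ 2) * volume (ball z.2 r) ≤ ∫⁻ y in ball z.2 r, ‖v s y‖ₑ ^ 2 := by
      rw [← setLIntegral_const]
      exact setLIntegral_mono' measurableSet_ball hpt
    calc ENNReal.ofReal (m₀ ^ 2) * volume (ball (0 : EuclideanSpace ℝ (Fin 3)) 1) * ENNReal.ofReal (r ^ 2)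
        = (ENNReal.ofReal r)⁻¹ * (ENNReal.ofReal (m₀ ^ 2) * volume (ball z.2 r)) := by
          rw [volume_ball_eq z.2 hr, ENNReal.ofReal_pow hr.le]
          have e : (ENNReal.ofReal r)⁻¹ * (ENNReal.ofReal (m₀ ^ 2) *
              (ENNReal.ofReal r ^ 3 * volume (ball (0 : EuclideanSpace ℝ (Fin 3)) 1))) =
              ((ENNReal.ofReal r)⁻¹ * ENNReal.ofReal r) *
                (ENNReal.ofReal (m₀ ^ 2) * volume (ball (0 : EuclideanSpace ℝ (Fin 3)) 1) *
                  ENNReal.ofReal r ^ 2) := by ring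
          rw [e, ENNReal.inv_mul_cancel hr0 ENNReal.ofReal_ne_top, one_mul]
      _ ≤ (ENNReal.ofReal r)⁻¹ * ∫⁻ y in ball z.2 r, ‖v s y‖ₑ ^ 2 := by gcongr
  -- the essential supremum over the window
  unfold cknAEss
  have hne : (volume.restrict (Ioo (z.1 - r ^ 2) z.1) : Measure ℝ) ≠ 0 := by
    rw [Ne, Measure.restrict_eq_zero, Real.volume_Ioo]
    simpa using hr.ne'
  calc ENNReal.ofReal (m₀ ^ 2) * volume (ball (0 : EuclideanSpace ℝ (Fin 3)) 1) * ENNReal.ofReal (r ^ 2)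
      = essSup (fun _ : ℝ => ENNReal.ofReal (m₀ ^ 2) * volume (ball (0 : EuclideanSpace ℝ (Fin 3)) 1) *
          ENNReal.ofReal (r ^ 2)) (volume.restrict (Ioo (z.1 - r ^ 2) z.1)) := (essSup_const _ hne).symm
    _ ≤ essSup (fun t : ℝ => (ENNReal.ofReal r)⁻¹ * ∫⁻ x in ball z.2 r, ‖v t x‖ₑ ^ 2)
          (volume.restrict (Ioo (z.1 - r ^ 2) z.1)) :=
        essSup_mono_ae ((ae_restrict_iff' measurableSet_Ioo).2 (Eventually.of_forall hslice))

/-- **No uniform lower bound on large cylinders.**  Under `A_ess(v; Q_r(z)) ≤ I`, a pointwise bound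
`m₀ ≤ ‖v‖` on `Q_r(z)` forces `m₀² |B₁| r² ≤ I`: the profile is `≲ √I / r` somewhere in every parabolic
cylinder of radius `r` (for `I < ∞`, `r → ∞`: arbitrarily small somewhere in every large cylinder —
nonzero constants, the critics' model row M10, are the special case `m₀ = ‖c‖`). [folklore] -/
theorem inf_norm_small_of_cknAEss_le {m₀ r : ℝ} (hm₀ : 0 ≤ m₀) (hr : 0 < r)
    {z : ℝ × EuclideanSpace ℝ (Fin 3)} {I : ℝ≥0∞} (hA : cknAEss r z v ≤ I)
    (hlow : ∀ q ∈ parabolicCylinder r z, m₀ ≤ ‖v q.1 q.2‖) :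
    ENNReal.ofReal (m₀ ^ 2) * volume (ball (0 : EuclideanSpace ℝ (Fin 3)) 1) * ENNReal.ofReal (r ^ 2) ≤
      I :=
  (mul_le_cknAEss_of_le_norm hm₀ hr hlow).trans hA

/-! ## `E` against a pointwise lower bound on the dissipation density -/

/-- **A pointwise lower bound on the dissipation density feeds `E`.**  If `g₀ ≤ |G(s, y)|²_F` on
`Q_r(z)` (`0 < r`), then `g₀ · |B₁| · r⁴ ≤ E(G; Q_r(z))`
(`E = r⁻¹ ∫∫_{Q_r} |G|²_F ≥ r⁻¹ g₀ · r² · |B₁| r³`). [folklore] -/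
theorem mul_le_cknE_of_le_frobeniusNormSq
    {G : ℝ → EuclideanSpace ℝ (Fin 3) → EuclideanSpace ℝ (Fin 3) →L[ℝ] EuclideanSpace ℝ (Fin 3)}
    {g₀ r : ℝ} (hr : 0 < r) {z : ℝ × EuclideanSpace ℝ (Fin 3)}
    (hlow : ∀ q ∈ parabolicCylinder r z, g₀ ≤ frobeniusNormSq (G q.1 q.2)) :
    ENNReal.ofReal g₀ * volume (ball (0 : EuclideanSpace ℝ (Fin 3)) 1) * ENNReal.ofReal (r ^ 4) ≤
      cknE r z G := by
  have hr0 : ENNReal.ofReal r ≠ 0 := (ENNReal.ofReal_pos.2 hr).ne'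
  have hvolQ : volume (parabolicCylinder r z) =
      ENNReal.ofReal (r ^ 2) * (ENNReal.ofReal r ^ 3 * volume (ball (0 : EuclideanSpace ℝ (Fin 3)) 1)) := by
    unfold parabolicCylinder
    rw [Measure.volume_eq_prod, Measure.prod_prod, Real.volume_Ioo, volume_ball_eq z.2 hr,
      show z.1 - (z.1 - r ^ 2) = r ^ 2 by ring]
  have hint : ENNReal.ofReal g₀ * volume (parabolicCylinder r z) ≤
      ∫⁻ q in parabolicCylinder r z, ENNReal.ofReal (frobeniusNormSq (G q.1 q.2)) := by
    rw [← setLIntegral_const]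
    exact setLIntegral_mono' (isOpen_parabolicCylinder r z).measurableSet fun q hq =>
      ENNReal.ofReal_le_ofReal (hlow q hq)
  unfold cknE
  calc ENNReal.ofReal g₀ * volume (ball (0 : EuclideanSpace ℝ (Fin 3)) 1) * ENNReal.ofReal (r ^ 4)
      = (ENNReal.ofReal r)⁻¹ * (ENNReal.ofReal g₀ * volume (parabolicCylinder r z)) := by
        rw [hvolQ, ENNReal.ofReal_pow hr.le, ENNReal.ofReal_pow hr.le]
        have h5 : ENNReal.ofReal r ^ 4 = (ENNReal.ofReal r)⁻¹ * (ENNReal.ofReal r ^ 2 * ENNReal.ofReal r ^ 3) := by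
          rw [show ENNReal.ofReal r ^ 2 * ENNReal.ofReal r ^ 3 = ENNReal.ofReal r * ENNReal.ofReal r ^ 4 by ring,
            ← mul_assoc, ENNReal.inv_mul_cancel hr0 ENNReal.ofReal_ne_top, one_mul]
        rw [h5]
        ring
    _ ≤ (ENNReal.ofReal r)⁻¹ *
          ∫⁻ q in parabolicCylinder r z, ENNReal.ofReal (frobeniusNormSq (G q.1 q.2)) := by gcongr

/-- **No uniform lower bound on the dissipation density on large cylinders.**  Under
`E(G; Q_r(z)) ≤ I`, `g₀ ≤ |G|²_F` on `Q_r(z)` forces `g₀ |B₁| r⁴ ≤ I`. [folklore] -/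
theorem inf_dissipation_small_of_cknE_le
    {G : ℝ → EuclideanSpace ℝ (Fin 3) → EuclideanSpace ℝ (Fin 3) →L[ℝ] EuclideanSpace ℝ (Fin 3)}
    {g₀ r : ℝ} (hr : 0 < r) {z : ℝ × EuclideanSpace ℝ (Fin 3)} {I : ℝ≥0∞}
    (hE : cknE r z G ≤ I) (hlow : ∀ q ∈ parabolicCylinder r z, g₀ ≤ frobeniusNormSq (G q.1 q.2)) :
    ENNReal.ofReal g₀ * volume (ball (0 : EuclideanSpace ℝ (Fin 3)) 1) * ENNReal.ofReal (r ^ 4) ≤ I :=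
  (mul_le_cknE_of_le_frobeniusNormSq hr hlow).trans hE

end Summit.NavierStokesRegularity.NavierStokesRegularity.Theorems.TypeIliouvilleNoTypeII.TypeIIZoom

end
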